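import Summits.ValiantsHypothesis.ValiantsHypothesis.Theorems.BarrierLeverPartitionMinorsChowIntegerCertificates
import Summits.ValiantsHypothesis.ValiantsHypothesis.Theorems.BarrierLeverPartitionMinorsChowSwap
import Summits.ValiantsHypothesis.ValiantsHypothesis.Theorems.BarrierLeverPartitionMinorsHitByVPNearPrincipalLayouts

/-!
# Route BarrierLever — Chow witnesses for partition minors (item 20172, CPM): the INCLUSION WITNESS
# `∏_a (1 + x_a)(1 − x_a + y_a)` and the PRINCIPAL-TYPE / AUTOMORPHIC layouts, every height, every size

Helper file (`--supports stmt-ValiantsHypothesis-20172`; cell valiant-natproofs, rung V4, 𝒟-side of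
door (c); seat valiant-natproofs-prover gen 12).  Closes NO item; definition-free.

Conventions of items 19717 / 20172 / 20195: `x_a = X (Fin.castAdd h a)`, `y_c = X (Fin.natAdd h c)`,
`E u w = Σ_{a∈u} e_{x_a} + Σ_{c∈w} e_{y_c}`; a layout `(u, w)` (`u w : Fin r → Finset (Fin h)`) is HIT
when some product of `h + h` affine forms `ℓ_k` has `det[coeff_{E (u i) (w j)} ∏ ℓ] ≠ 0`.

THE INCLUSION WITNESS.  The product of the `h + h` affine forms `1 + x_a` and `1 − x_a + y_a`
(`a < h`) has the `0/1` partition matrix of the CONTAINMENT ORDER: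
`coeff_{x^u y^w} ∏_a (1 + x_a)(1 − x_a + y_a) = [u ⊆ w]` (`coeff_partitionExpo_inclusionWitness`;
per coordinate `(1 + x)(1 − x + y) = 1 + y + xy − x²`, and `x²` never contributes to a multilinear
coefficient).  Hence (the Chow-product counterparts, for item 20172, of val-np-p3's
`partitionMinor_hit_of_principal` / `partitionMinor_hit_of_automorphic` for item 19717, whose
witness `∏_a (1 + x_a y_a)` is NOT a product of affine forms):

* `chow_hit_of_inclusionMinor` — every layout whose inclusion minor `det[[u i ⊆ w j]]` is nonzero is
  hit by this ONE explicit product, at every height and every size `r ≤ 2^h`;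
* `chow_hit_of_principal` — PRINCIPAL-TYPE layouts (the columns are a rearrangement of the distinct
  rows, `w j = u (κ j)`): the minor is a permuted inclusion matrix of distinct sets, unimodular
  (`ProductStateSums.det_inclusionMatrix`);
* `chow_hit_of_automorphic` — AUTOMORPHIC layouts `w j = π (u (κ j))` (a coordinate relabelling of a
  rearrangement of the rows), by `chow_hit_relabel`;
* `chow_hit_of_reverseInclusionMinor` — the mirror class `det[[w j ⊆ u i]] ≠ 0`, by `chow_hit_swap`.

Note: principal-type layouts are never LOCKED (row and column degrees coincide), so the core engine
`chow_hit_of_core` splits them — but into smaller layouts of unknown status; the direct witness here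
settles the whole class uniformly in `h`.

WHAT THIS IS NOT: a structural class of item 20172 of every size, not the item (layouts with singular
inclusion minors in both directions, e.g. the locked cores, are untouched); nothing on items 20195 /
19717 beyond the implication 20172 ⇒ 19717, on crux stmt-ValiantsHypothesis-14610, or on `VP` versus
`VNP`.
-/

set_option linter.dupNamespace false

namespace Summit.ValiantsHypothesis.ValiantsHypothesis.Theorems.BarrierLever.ChowFactor

open Finset MvPolynomial
open Summit.ValiantsHypothesis.ValiantsHypothesis.Theorems.BarrierLever.ProductStateSums
  (partitionExpo_apply_castAdd partitionExpo_apply_natAdd det_inclusionMatrix)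

noncomputable section

variable {h : ℕ}

/-! ## 1. One factor `1 + x_a`, one factor `1 − x_a + y_a` -/

/-- Multiplying by `1 + x_a` adds the `a`-deleted row: `coeff_{E u w}(f·(1 + x_a)) =
coeff_{E u w} f + [a ∈ u]·coeff_{E (u∖a) w} f`. -/
theorem coeff_partitionExpo_mul_one_add_X {R : Type*} [CommSemiring R]
    (f : MvPolynomial (Fin (h + h)) R) (a : Fin h) (u w : Finset (Fin h)) :
    coeff (∑ b ∈ u, Finsupp.single (Fin.castAdd h b) 1 + ∑ c ∈ w, Finsupp.single (Fin.natAdd h c) 1)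
        (f * (1 + X (Fin.castAdd h a))) =
      coeff (∑ b ∈ u, Finsupp.single (Fin.castAdd h b) 1 + ∑ c ∈ w, Finsupp.single (Fin.natAdd h c) 1) f +
        if a ∈ u then coeff (∑ b ∈ u.erase a, Finsupp.single (Fin.castAdd h b) 1 +
          ∑ c ∈ w, Finsupp.single (Fin.natAdd h c) 1) f else 0 := by
  classical
  rw [mul_add, mul_one, coeff_add, coeff_mul_X']
  congr 1
  by_cases ha : a ∈ u
  · rw [if_pos ((castAdd_mem_support_partitionExpo u w a).mpr ha),
      partitionExpo_tsub_single_castAdd, if_pos ha]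
  · rw [if_neg (fun hm => ha ((castAdd_mem_support_partitionExpo u w a).mp hm)), if_neg ha]

/-- Multiplying by `1 − x_a + y_a`: `coeff_{E u w}(f·(1 − x_a + y_a)) =
coeff_{E u w} f − [a ∈ u]·coeff_{E (u∖a) w} f + [a ∈ w]·coeff_{E u (w∖a)} f`. -/
theorem coeff_partitionExpo_mul_one_sub_X_add_Y {R : Type*} [CommRing R]
    (f : MvPolynomial (Fin (h + h)) R) (a : Fin h) (u w : Finset (Fin h)) :
    coeff (∑ b ∈ u, Finsupp.single (Fin.castAdd h b) 1 + ∑ c ∈ w, Finsupp.single (Fin.natAdd h c) 1)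
        (f * (1 - X (Fin.castAdd h a) + X (Fin.natAdd h a))) =
      coeff (∑ b ∈ u, Finsupp.single (Fin.castAdd h b) 1 + ∑ c ∈ w, Finsupp.single (Fin.natAdd h c) 1) f -
        (if a ∈ u then coeff (∑ b ∈ u.erase a, Finsupp.single (Fin.castAdd h b) 1 +
          ∑ c ∈ w, Finsupp.single (Fin.natAdd h c) 1) f else 0) +
        (if a ∈ w then coeff (∑ b ∈ u, Finsupp.single (Fin.castAdd h b) 1 +
          ∑ c ∈ w.erase a, Finsupp.single (Fin.natAdd h c) 1) f else 0) := by
  classical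
  rw [mul_add, mul_sub, mul_one, coeff_add, coeff_sub, coeff_mul_X', coeff_mul_X']
  have hx : (if Fin.castAdd h a ∈ (∑ b ∈ u, Finsupp.single (Fin.castAdd h b) 1 +
        ∑ c ∈ w, Finsupp.single (Fin.natAdd h c) 1 : Fin (h + h) →₀ ℕ).support then
      coeff ((∑ b ∈ u, Finsupp.single (Fin.castAdd h b) 1 +
        ∑ c ∈ w, Finsupp.single (Fin.natAdd h c) 1 : Fin (h + h) →₀ ℕ) -
          Finsupp.single (Fin.castAdd h a) 1) f else 0) =
      if a ∈ u then coeff (∑ b ∈ u.erase a, Finsupp.single (Fin.castAdd h b) 1 +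
        ∑ c ∈ w, Finsupp.single (Fin.natAdd h c) 1) f else 0 := by
    by_cases ha : a ∈ u
    · rw [if_pos ((castAdd_mem_support_partitionExpo u w a).mpr ha),
        partitionExpo_tsub_single_castAdd, if_pos ha]
    · rw [if_neg (fun hm => ha ((castAdd_mem_support_partitionExpo u w a).mp hm)), if_neg ha]
  have hy : (if Fin.natAdd h a ∈ (∑ b ∈ u, Finsupp.single (Fin.castAdd h b) 1 +
        ∑ c ∈ w, Finsupp.single (Fin.natAdd h c) 1 : Fin (h + h) →₀ ℕ).support then
      coeff ((∑ b ∈ u, Finsupp.single (Fin.castAdd h b) 1 +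
        ∑ c ∈ w, Finsupp.single (Fin.natAdd h c) 1 : Fin (h + h) →₀ ℕ) -
          Finsupp.single (Fin.natAdd h a) 1) f else 0) =
      if a ∈ w then coeff (∑ b ∈ u, Finsupp.single (Fin.castAdd h b) 1 +
        ∑ c ∈ w.erase a, Finsupp.single (Fin.natAdd h c) 1) f else 0 := by
    by_cases ha : a ∈ w
    · rw [if_pos ((natAdd_mem_support_partitionExpo u w a).mpr ha),
        partitionExpo_tsub_single, if_pos ha]
    · rw [if_neg (fun hm => ha ((natAdd_mem_support_partitionExpo u w a).mp hm)), if_neg ha]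
  rw [hx, hy]

/-! ## 2. The partition matrix of the inclusion witness is the containment matrix -/

/-- Partial products of the inclusion witness over a set `S` of coordinates:
`coeff_{E u w} ∏_{a ∈ S} (1 + x_a)(1 − x_a + y_a) = [u ⊆ w ⊆ S]`. -/
theorem coeff_partitionExpo_inclusionWitness_subset {R : Type*} [CommRing R] (S : Finset (Fin h))
    (u w : Finset (Fin h)) :
    coeff (∑ b ∈ u, Finsupp.single (Fin.castAdd h b) 1 + ∑ c ∈ w, Finsupp.single (Fin.natAdd h c) 1)
        (∏ a ∈ S, ((1 + X (Fin.castAdd h a)) * (1 - X (Fin.castAdd h a) + X (Fin.natAdd h a)) :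
          MvPolynomial (Fin (h + h)) R)) =
      if u ⊆ w ∧ w ⊆ S then 1 else 0 := by
  classical
  induction S using Finset.induction_on generalizing u w with
  | empty =>
    rw [Finset.prod_empty, coeff_partitionExpo_one]
    by_cases huw : u = ∅ ∧ w = ∅
    · obtain ⟨rfl, rfl⟩ := huw
      simp
    · rw [if_neg huw, if_neg]
      rintro ⟨hu, hw⟩
      have hw' : w = ∅ := Finset.subset_empty.mp hw
      subst hw'
      exact huw ⟨Finset.subset_empty.mp hu, rfl⟩
  | insert a S haS ih =>
    rw [Finset.prod_insert haS, mul_comm, ← mul_assoc, coeff_partitionExpo_mul_one_sub_X_add_Y,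
      coeff_partitionExpo_mul_one_add_X, coeff_partitionExpo_mul_one_add_X,
      coeff_partitionExpo_mul_one_add_X, ih, ih, ih, ih, ih]
    have hee : a ∉ u.erase a := Finset.notMem_erase a u
    simp only [hee, if_false, add_zero]
    -- vanishing facts (`a ∉ S`)
    have v1 : a ∈ w → ∀ v : Finset (Fin h), ¬ (v ⊆ w ∧ w ⊆ S) := fun haw v hh => haS (hh.2 haw)
    have v2 : a ∈ u → ∀ v : Finset (Fin h), ¬ (u ⊆ v.erase a ∧ v.erase a ⊆ S) :=
      fun hau v hh => (Finset.notMem_erase a v) (hh.1 hau)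
    have v3 : a ∈ u → a ∉ w → ∀ T : Finset (Fin h), ¬ (u ⊆ w ∧ w ⊆ T) := fun hau haw T hh => haw (hh.1 hau)
    by_cases hau : a ∈ u
    · by_cases haw : a ∈ w
      · -- `a ∈ u`, `a ∈ w`: only the doubly-deleted term survives
        simp only [hau, haw, ↓reduceIte, if_neg (v1 haw u), if_neg (v1 haw (u.erase a)),
          if_neg (v2 hau w), zero_add, add_zero, sub_self]
        have key : (u ⊆ w ∧ w ⊆ insert a S) ↔ (u.erase a ⊆ w.erase a ∧ w.erase a ⊆ S) := by
          constructor
          · rintro ⟨hsub, hS⟩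
            exact ⟨fun b hb => Finset.mem_erase.mpr ⟨(Finset.mem_erase.mp hb).1,
                hsub (Finset.mem_erase.mp hb).2⟩,
              fun c hc => (Finset.mem_insert.mp (hS (Finset.mem_erase.mp hc).2)).resolve_left
                (Finset.mem_erase.mp hc).1⟩
          · rintro ⟨hsub, hS⟩
            refine ⟨fun b hb => ?_, fun c hc => ?_⟩
            · by_cases hba : b = a
              · rw [hba]; exact haw
              · exact (Finset.mem_erase.mp (hsub (Finset.mem_erase.mpr ⟨hba, hb⟩))).2
            · by_cases hca : c = a
              · rw [hca]; exact Finset.mem_insert_self _ _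
              · exact Finset.mem_insert_of_mem (hS (Finset.mem_erase.mpr ⟨hca, hc⟩))
        by_cases hg : u ⊆ w ∧ w ⊆ insert a S
        · rw [if_pos hg, if_pos (key.mp hg)]
        · rw [if_neg hg, if_neg (fun hh => hg (key.mpr hh))]
      · -- `a ∈ u`, `a ∉ w`: the row is not contained in the column
        simp only [hau, haw, ↓reduceIte, if_neg (v3 hau haw S), if_neg (v3 hau haw _), zero_add,
          add_zero, sub_self]
    · by_cases haw : a ∈ w
      · -- `a ∉ u`, `a ∈ w`
        simp only [hau, haw, ↓reduceIte, if_neg (v1 haw u), zero_add, add_zero, sub_zero]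
        have key : (u ⊆ w ∧ w ⊆ insert a S) ↔ (u ⊆ w.erase a ∧ w.erase a ⊆ S) := by
          constructor
          · rintro ⟨hsub, hS⟩
            exact ⟨fun b hb => Finset.mem_erase.mpr ⟨fun e => hau (e ▸ hb), hsub hb⟩,
              fun c hc => (Finset.mem_insert.mp (hS (Finset.mem_erase.mp hc).2)).resolve_left
                (Finset.mem_erase.mp hc).1⟩
          · rintro ⟨hsub, hS⟩
            refine ⟨fun b hb => (Finset.mem_erase.mp (hsub hb)).2, fun c hc => ?_⟩
            by_cases hca : c = a
            · rw [hca]; exact Finset.mem_insert_self _ _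
            · exact Finset.mem_insert_of_mem (hS (Finset.mem_erase.mpr ⟨hca, hc⟩))
        by_cases hg : u ⊆ w ∧ w ⊆ insert a S
        · rw [if_pos hg, if_pos (key.mp hg)]
        · rw [if_neg hg, if_neg (fun hh => hg (key.mpr hh))]
      · -- `a ∉ u`, `a ∉ w`
        simp only [hau, haw, ↓reduceIte, add_zero, sub_zero]
        have key : (u ⊆ w ∧ w ⊆ insert a S) ↔ (u ⊆ w ∧ w ⊆ S) := by
          constructor
          · rintro ⟨hsub, hS⟩
            exact ⟨hsub, fun c hc => (Finset.mem_insert.mp (hS hc)).resolve_left (fun e => haw (e ▸ hc))⟩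
          · rintro ⟨hsub, hS⟩
            exact ⟨hsub, hS.trans (Finset.subset_insert _ _)⟩
        by_cases hg : u ⊆ w ∧ w ⊆ insert a S
        · rw [if_pos hg, if_pos (key.mp hg)]
        · rw [if_neg hg, if_neg (fun hh => hg (key.mpr hh))]

/-- **The partition matrix of the inclusion witness is the containment matrix**:
`coeff_{x^u y^w} ∏_a (1 + x_a)(1 − x_a + y_a) = [u ⊆ w]`. -/
theorem coeff_partitionExpo_inclusionWitness {R : Type*} [CommRing R] (u w : Finset (Fin h)) :
    coeff (∑ b ∈ u, Finsupp.single (Fin.castAdd h b) 1 + ∑ c ∈ w, Finsupp.single (Fin.natAdd h c) 1)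
        (∏ a : Fin h, ((1 + X (Fin.castAdd h a)) * (1 - X (Fin.castAdd h a) + X (Fin.natAdd h a)) :
          MvPolynomial (Fin (h + h)) R)) =
      if u ⊆ w then 1 else 0 := by
  rw [coeff_partitionExpo_inclusionWitness_subset]
  by_cases huw : u ⊆ w
  · rw [if_pos ⟨huw, Finset.subset_univ _⟩, if_pos huw]
  · rw [if_neg (fun hh => huw hh.1), if_neg huw]

/-! ## 3. The hit classes -/

/-- The `h + h` inclusion forms, `1 + x_a` then `1 − x_a + y_a`, indexed by `Fin (h + h)`. -/
theorem prod_inclusionForms_eq :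
    (∏ k : Fin (h + h), Fin.addCases (motive := fun _ => MvPolynomial (Fin (h + h)) ℂ)
        (fun a => 1 + X (Fin.castAdd h a)) (fun a => 1 - X (Fin.castAdd h a) + X (Fin.natAdd h a)) k) =
      ∏ a : Fin h, ((1 + X (Fin.castAdd h a)) * (1 - X (Fin.castAdd h a) + X (Fin.natAdd h a)) :
        MvPolynomial (Fin (h + h)) ℂ) := by
  rw [Fin.prod_univ_add, ← Finset.prod_mul_distrib]
  refine Finset.prod_congr rfl fun a _ => ?_
  rw [Fin.addCases_left, Fin.addCases_right]

/-- The inclusion forms are affine. -/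
theorem totalDegree_inclusionForms_le (k : Fin (h + h)) :
    (Fin.addCases (motive := fun _ => MvPolynomial (Fin (h + h)) ℂ)
        (fun a => 1 + X (Fin.castAdd h a)) (fun a => 1 - X (Fin.castAdd h a) + X (Fin.natAdd h a)) k
      ).totalDegree ≤ 1 := by
  refine Fin.addCases (fun a => ?_) (fun a => ?_) k
  · rw [Fin.addCases_left]
    refine (totalDegree_add _ _).trans (max_le ?_ (isHomogeneous_X ℂ _).totalDegree_le)
    rw [totalDegree_one]; exact Nat.zero_le _
  · rw [Fin.addCases_right]
    refine (totalDegree_add _ _).trans (max_le ?_ (isHomogeneous_X ℂ _).totalDegree_le)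
    refine (totalDegree_sub _ _).trans (max_le ?_ (isHomogeneous_X ℂ _).totalDegree_le)
    rw [totalDegree_one]; exact Nat.zero_le _

/-- **Every layout with a nonzero INCLUSION MINOR is Chow-hit**, at every height and every size, by the
one explicit product `∏_a (1 + x_a)(1 − x_a + y_a)`. -/
theorem chow_hit_of_inclusionMinor {r : ℕ} (u w : Fin r → Finset (Fin h))
    (hdet : (Matrix.of fun i j : Fin r => if u i ⊆ w j then (1 : ℂ) else 0).det ≠ 0) :
    ∃ ℓ : Fin (h + h) → MvPolynomial (Fin (h + h)) ℂ, (∀ q, (ℓ q).totalDegree ≤ 1) ∧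
      (Matrix.of fun i j : Fin r => coeff
        (∑ b ∈ u i, Finsupp.single (Fin.castAdd h b) 1 + ∑ d ∈ w j, Finsupp.single (Fin.natAdd h d) 1)
        (∏ q, ℓ q)).det ≠ 0 := by
  refine ⟨fun k => Fin.addCases (motive := fun _ => MvPolynomial (Fin (h + h)) ℂ)
      (fun a => 1 + X (Fin.castAdd h a)) (fun a => 1 - X (Fin.castAdd h a) + X (Fin.natAdd h a)) k,
    totalDegree_inclusionForms_le, ?_⟩
  have hM : (Matrix.of fun i j : Fin r => coeff
      (∑ b ∈ u i, Finsupp.single (Fin.castAdd h b) 1 + ∑ d ∈ w j, Finsupp.single (Fin.natAdd h d) 1)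
      (∏ q : Fin (h + h), Fin.addCases (motive := fun _ => MvPolynomial (Fin (h + h)) ℂ)
        (fun a => 1 + X (Fin.castAdd h a)) (fun a => 1 - X (Fin.castAdd h a) + X (Fin.natAdd h a)) q)) =
      Matrix.of fun i j : Fin r => if u i ⊆ w j then (1 : ℂ) else 0 := by
    ext i j
    rw [Matrix.of_apply, Matrix.of_apply, prod_inclusionForms_eq, coeff_partitionExpo_inclusionWitness]
  rw [hM]
  exact hdet

/-- **PRINCIPAL-TYPE layouts are Chow-hit (item 20172's conclusion), every height, every size**: if the
columns are a rearrangement of the distinct rows, `w j = u (κ j)`, the inclusion minor is a permuted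
inclusion matrix of distinct sets, of determinant `±1`. -/
theorem chow_hit_of_principal {r : ℕ} (u w : Fin r → Finset (Fin h)) (hu : Function.Injective u)
    (κ : Equiv.Perm (Fin r)) (hκ : ∀ j, w j = u (κ j)) :
    ∃ ℓ : Fin (h + h) → MvPolynomial (Fin (h + h)) ℂ, (∀ q, (ℓ q).totalDegree ≤ 1) ∧
      (Matrix.of fun i j : Fin r => coeff
        (∑ b ∈ u i, Finsupp.single (Fin.castAdd h b) 1 + ∑ d ∈ w j, Finsupp.single (Fin.natAdd h d) 1)
        (∏ q, ℓ q)).det ≠ 0 := by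
  classical
  refine chow_hit_of_inclusionMinor u w ?_
  have hM : (Matrix.of fun i j : Fin r => if u i ⊆ w j then (1 : ℂ) else 0) =
      (Matrix.of fun i j : Fin r => if u i ⊆ u j then (1 : ℂ) else 0).submatrix id κ := by
    ext i j
    rw [Matrix.submatrix_apply, Matrix.of_apply, Matrix.of_apply, hκ j, id]
  rw [hM, Matrix.det_permute', det_inclusionMatrix u hu, mul_one]
  exact Int.cast_ne_zero.mpr (Units.ne_zero _)

/-- **AUTOMORPHIC layouts are Chow-hit**: columns = a coordinate relabelling `π` of a rearrangement
`κ` of the distinct rows, `w j = (u (κ j)).map π`. -/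
theorem chow_hit_of_automorphic {r : ℕ} (u w : Fin r → Finset (Fin h)) (hu : Function.Injective u)
    (κ : Equiv.Perm (Fin r)) (π : Equiv.Perm (Fin h)) (hκ : ∀ j, w j = (u (κ j)).map π.toEmbedding) :
    ∃ ℓ : Fin (h + h) → MvPolynomial (Fin (h + h)) ℂ, (∀ q, (ℓ q).totalDegree ≤ 1) ∧
      (Matrix.of fun i j : Fin r => coeff
        (∑ b ∈ u i, Finsupp.single (Fin.castAdd h b) 1 + ∑ d ∈ w j, Finsupp.single (Fin.natAdd h d) 1)
        (∏ q, ℓ q)).det ≠ 0 := by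
  classical
  have hw : w = fun j => (u (κ j)).map π.toEmbedding := funext hκ
  subst hw
  have hrel := chow_hit_relabel (Equiv.refl (Fin h)) π u (fun j => u (κ j))
    (chow_hit_of_principal u (fun j => u (κ j)) hu κ (fun _ => rfl))
  have hu' : ∀ i, (u i).map (Equiv.refl (Fin h)).toEmbedding = u i := fun i => by
    rw [Equiv.refl_toEmbedding, Finset.map_refl]
  simp only [hu'] at hrel
  exact hrel

/-- **The mirror class**: layouts with a nonzero REVERSE inclusion minor `det[[w j ⊆ u i]] ≠ 0` are
Chow-hit (swap `x ↔ y`). -/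
theorem chow_hit_of_reverseInclusionMinor {r : ℕ} (u w : Fin r → Finset (Fin h))
    (hdet : (Matrix.of fun i j : Fin r => if w j ⊆ u i then (1 : ℂ) else 0).det ≠ 0) :
    ∃ ℓ : Fin (h + h) → MvPolynomial (Fin (h + h)) ℂ, (∀ q, (ℓ q).totalDegree ≤ 1) ∧
      (Matrix.of fun i j : Fin r => coeff
        (∑ b ∈ u i, Finsupp.single (Fin.castAdd h b) 1 + ∑ d ∈ w j, Finsupp.single (Fin.natAdd h d) 1)
        (∏ q, ℓ q)).det ≠ 0 := by
  refine chow_hit_swap u w (chow_hit_of_inclusionMinor w u ?_)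
  rw [← Matrix.det_transpose]
  have hT : (Matrix.of fun i j : Fin r => if w i ⊆ u j then (1 : ℂ) else 0).transpose =
      Matrix.of fun i j : Fin r => if w j ⊆ u i then (1 : ℂ) else 0 := by
    ext i j; rfl
  rw [hT]
  exact hdet

end

end Summit.ValiantsHypothesis.ValiantsHypothesis.Theorems.BarrierLever.ChowFactor
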